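/-
Copyright (c) 2026 the pub-hodgecm-mathlib formalisation cell (harness21).  Prover seat hodgecm-mathlib-K2E4-p10 (g9), Track B «K2-LIT»,
#184♮ = hLiu418 = `stmt-HodgeConjecture-24832`; socket #41, KIND W (n = 2), the (x-b) chain with LOCAL EXPONENTS: the decay and presentation letters with
exponents `N₁ N′ (N₂ N₃)` chosen PER `z` (as the archimedean payers deliver them), absorbed into the TOP's GLOBAL `N_W := 0` by the Gaussian factor.
THEOREMS ONLY (no `def`, no `instance`, no notation, no named-fact hypothesis, no `sorry`).
-/
import Summits.HodgeConjecture.HodgeConjecture.Theorems.K2LiuSiegelEisensteinKindWPackage        -- ★ p862636 STAGE 1 (⊇ ★ Instance `hsupp_of_local`, ★ Decay `hdec_of_letters`, ★ G1, ★ G2)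
import Summits.HodgeConjecture.HodgeConjecture.Theorems.K2LiuSiegelEisensteinKindWPresentation   -- ★ p862693 STAGE 2
import Summits.HodgeConjecture.HodgeConjecture.Theorems.K2LiuIwasawaHeightLatticeSumBound        -- ★ G7-C `exists_adelicHeightGL_floor`
import Mathlib.Analysis.Complex.Exponential
import HarnessLib

/-!
# Crux `HLiu418`, socket #41, KIND W — `K2LiuSiegelEisensteinKindWLocalExponents`: THE (x-b) CHAIN WITH EXPONENTS LOCAL IN `s`
# (`hdec_of_letters_local`, `dloc_of_presentation_local`, `exists_kindW_letters_of_globalLetters_local`; the TOP's `N_W := 0`)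

Cell `hodgecm-mathlib`, crux item hLiu418 = `stmt-HodgeConjecture-24832` (helper lane `--supports … --as helper`, count-neutral), route of record `HCCMUnconditional`;
squad K2 ∕ K2Liu, road `K2_Liu`, socket #41 `sig_K2LiuSiegelEisensteinContinuation`, KIND W.  The TOP's decay letter
`hdec : ∀ z, 0 < re z → ∃ C a c a′ r, … ‖A S s h‖ ≤ C ‖h‖^a · e^{−c ‖h‖^{−a′} τ S} · (1 + τ S)^{N_W}` has a GLOBAL polynomial exponent `N_W`, and so do the ★ letters
of this seat's chain (★ `hdec_of_letters`: `N₁ N′`; ★ `dloc_of_presentation`: `N₁ N′ N₂ N₃`; ★ STAGE 1; ★ `kindW_block_of_record`: `(N₁ N' N₂ N₃ : ℕ)` BEFORE `harch`,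
`hfsize`).  The ARCHIMEDEAN payers cannot honour that: the continued confluent hypergeometric letter at the index `Z = yᴴ x y` is bounded locally uniformly in `s` by
`A(T) · e^{−c τ(Z)} · (1 + μ(Z)^{−B(T)})` with the defect exponent `B(T)` and the polynomial prefactor `|det Z|^{re s − κ}` GROWING with the compact `T ∋ s`
[Shimura1982, §3 Thm. 3.1], [Shimura1997, §19].  THIS FILE removes the obstruction on this seat's side:
* §1 **`one_add_pow_mul_exp_neg_le`** — the ABSORPTION of any polynomial in the size into the Gaussian, per `z`:
  `e^{−c H^{−a′} τ} (1 + τ)^M ≤ 2^M (c₀^{−a′M} + M! (2∕c)^M) · H^{a′M} · e^{−(c∕2) H^{−a′} τ}` for `τ ≥ 0`, `H ≥ c₀ > 0` (the height floor ★ `exists_adelicHeightGL_floor`),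
  from Mathlib `Real.pow_div_factorial_le_exp` (`(uτ)^M∕M! ≤ e^{uτ}`, `u = (c∕2)H^{−a′}`);
* §2 **`hdec_of_letters_local`** — ★ `hdec_of_letters` with the local letter's exponents `N₁ N′` INSIDE the `∀ z` (`hloc : ∀ z, 0 < re z → ∃ N₁ N′ C a c a′ r, …`), output the
  TOP's `hdec` with `N_W := 0`: per `z`, ★ `hdec_of_letters` applied to the family TRUNCATED to the `z`-ball (outside it `A := 0` satisfies every letter), then §1;
* §3 **`dloc_of_presentation_local`** — ★ `dloc_of_presentation` with `harch`'s `N₁ N′` and `hfsize`'s `N₂ N₃` inside the `∀ z`, output (D-loc) with `N₁ + N₂`, `N′` inside the `∀ z`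
  (= §2's `hloc` shape); the proof is ★ STAGE 2's, per `z`;
* §4 **`exists_kindW_letters_of_globalLetters_local`** — ★ STAGE 1 with (D-loc) in §2's local shape ⟹ the TOP's KIND-W block VERBATIM (`N_W := 0`).
The head of record with local exponents (`kindW_block_of_record_local`) is the next file `K2LiuSiegelEisensteinKindWOfRecordLocal`.
[MoeglinWaldspurger1995, II.1.7, IV.1.9], [Shimura1982, §3], [Shimura1997, §18.4 Prop. 18.14, §19], [BorelJacquet1979, §1.2], [Tan1999, §4 Prop. 4.8].
HONEST LABEL.  Count-neutral helper, closes no socket: `HC_CM` is proved only modulo the 7 printed citations (2 remaining named inputs: hLiu418 =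
`stmt-HodgeConjecture-24832`, h413 = `stmt-HodgeConjecture-24833`) until rung 0 closes.
-/

set_option autoImplicit false
set_option linter.dupNamespace false -- the mandated namespace repeats `HodgeConjecture.HodgeConjecture`

noncomputable section

open scoped Matrix BigOperators NNReal
-- `Classical` is needed to see the Mathlib normed-ring instances on `mixedSpace L` (note H5 of ★ `AdelicGLnGlue`; as the TOP's `hτ`)
open scoped Classical
open NumberField NumberField.InfinitePlace IsDedekindDomain MeasureTheory

namespace Summit.HodgeConjecture.HodgeConjecture.Cruxes.HLiu418.K2LiuSiegelEisensteinKindWLocalExponents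

open Literature.NumberTheory.Automorphic Literature.NumberTheory.GaloisRepresentations Literature.NumberTheory.LFunctions
open Literature.NumberTheory.GelbartRogawski1991 Literature.NumberTheory.GelbartRogawski1991.GRConstruction
open Literature.NumberTheory.K2Lit.SiegelDoubled
open Summit.HodgeConjecture.HodgeConjecture.Cruxes.HLiu418.K2LiuSiegelUnipotentFourierDefs
open Summit.HodgeConjecture.HodgeConjecture.Cruxes.HLiu418.K2LiuGoodPlaceWhittakerEulerAssembly
open Summit.HodgeConjecture.HodgeConjecture.Cruxes.HLiu418.K2LiuSiegelEisensteinKindWInstance (hsupp_of_local)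
open Summit.HodgeConjecture.HodgeConjecture.Cruxes.HLiu418.K2LiuSiegelEisensteinKindWDecay (hdec_of_letters)
open Summit.HodgeConjecture.HodgeConjecture.Cruxes.HLiu418.K2LiuIwasawaHeightLatticeSumBound (exists_adelicHeightGL_floor)

/-! ## §1 Absorption of a polynomial in the size into the Gaussian -/

/-- **ABSORPTION**: for `0 < c`, `0 < c₀ ≤ H`, `0 ≤ a′`, `0 ≤ τ` and `M : ℕ`,
`e^{−c H^{−a′} τ} (1 + τ)^M ≤ 2^M (c₀^{−a′M} + M!·(2∕c)^M) · H^{a′M} · e^{−(c∕2) H^{−a′} τ}`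
(`(1+τ)^M ≤ 2^M(1 + τ^M)`, `τ^M ≤ M! u^{−M} e^{uτ}` with `u = (c∕2)H^{−a′}` by `(uτ)^M∕M! ≤ e^{uτ}`, `u^{−M} = (2∕c)^M H^{a′M}`, `1 ≤ c₀^{−a′M} H^{a′M}`).
[cite: MoeglinWaldspurger1995, II.1.7] -/
theorem one_add_pow_mul_exp_neg_le {c c₀ H a' τ : ℝ} (hc : 0 < c) (hc₀ : 0 < c₀) (hH : c₀ ≤ H) (ha' : 0 ≤ a') (hτ : 0 ≤ τ) (M : ℕ) :
    Real.exp (-(c * H ^ (-a') * τ)) * (1 + τ) ^ M ≤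
      (2 : ℝ) ^ M * (c₀ ^ (-(a' * M)) + (M.factorial : ℝ) * (2 / c) ^ M) * H ^ (a' * M) * Real.exp (-(c / 2 * H ^ (-a') * τ)) := by
  have hH0 : 0 < H := lt_of_lt_of_le hc₀ hH
  have hE0 : 0 < H ^ (-a') := Real.rpow_pos_of_pos hH0 _
  set u : ℝ := c / 2 * H ^ (-a') with hu
  have hu0 : 0 < u := by positivity
  -- `(1 + τ)^M ≤ 2^M (1 + τ^M)`
  have h1 : (1 + τ) ^ M ≤ (2 : ℝ) ^ M * (1 + τ ^ M) := by
    rcases le_total τ 1 with hτ1 | hτ1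
    · calc (1 + τ) ^ M ≤ (2 : ℝ) ^ M := pow_le_pow_left₀ (by linarith) (by linarith) M
        _ ≤ (2 : ℝ) ^ M * (1 + τ ^ M) := le_mul_of_one_le_right (by positivity) (le_add_of_nonneg_right (pow_nonneg hτ M))
    · calc (1 + τ) ^ M ≤ (2 * τ) ^ M := pow_le_pow_left₀ (by linarith) (by linarith) M
        _ = (2 : ℝ) ^ M * τ ^ M := mul_pow _ _ _
        _ ≤ (2 : ℝ) ^ M * (1 + τ ^ M) := mul_le_mul_of_nonneg_left (le_add_of_nonneg_left zero_le_one) (by positivity)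
  -- `τ^M ≤ M! u^{−M} e^{uτ}`
  have h2 : τ ^ M ≤ (M.factorial : ℝ) * (u⁻¹) ^ M * Real.exp (u * τ) := by
    have h := Real.pow_div_factorial_le_exp (u * τ) (mul_nonneg hu0.le hτ) M
    have hM : (0 : ℝ) < M.factorial := by exact_mod_cast M.factorial_pos
    rw [div_le_iff₀ hM, mul_pow] at h
    calc τ ^ M = (u⁻¹) ^ M * (u ^ M * τ ^ M) := by rw [← mul_assoc, ← mul_pow, inv_mul_cancel₀ hu0.ne', one_pow, one_mul]
      _ ≤ (u⁻¹) ^ M * (Real.exp (u * τ) * M.factorial) := mul_le_mul_of_nonneg_left h (by positivity)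
      _ = (M.factorial : ℝ) * (u⁻¹) ^ M * Real.exp (u * τ) := by ring
  -- `u^{−M} = (2∕c)^M H^{a′M}`
  have h3 : (u⁻¹) ^ M = (2 / c) ^ M * H ^ (a' * M) := by
    rw [hu, mul_inv, Real.rpow_neg hH0.le, inv_inv, inv_div, mul_pow, ← Real.rpow_natCast (H ^ a'), ← Real.rpow_mul hH0.le]
  -- `1 ≤ c₀^{−a′M} H^{a′M}` and `1 ≤ e^{uτ}`
  have h4 : (1 : ℝ) ≤ c₀ ^ (-(a' * M)) * H ^ (a' * M) := by
    rw [Real.rpow_neg hc₀.le, ← div_eq_inv_mul, one_le_div (Real.rpow_pos_of_pos hc₀ _)]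
    exact Real.rpow_le_rpow hc₀.le hH (by positivity)
  have h5 : (1 : ℝ) ≤ Real.exp (u * τ) := Real.one_le_exp (mul_nonneg hu0.le hτ)
  have hkey : 1 + τ ^ M ≤ (c₀ ^ (-(a' * M)) + (M.factorial : ℝ) * (2 / c) ^ M) * H ^ (a' * M) * Real.exp (u * τ) := by
    have hA : (1 : ℝ) ≤ c₀ ^ (-(a' * M)) * H ^ (a' * M) * Real.exp (u * τ) := one_le_mul_of_one_le_of_one_le h4 h5
    have hB : τ ^ M ≤ (M.factorial : ℝ) * ((2 / c) ^ M * H ^ (a' * M)) * Real.exp (u * τ) := by rw [← h3]; exact h2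
    calc 1 + τ ^ M ≤ c₀ ^ (-(a' * M)) * H ^ (a' * M) * Real.exp (u * τ) + (M.factorial : ℝ) * ((2 / c) ^ M * H ^ (a' * M)) * Real.exp (u * τ) :=
          add_le_add hA hB
      _ = (c₀ ^ (-(a' * M)) + (M.factorial : ℝ) * (2 / c) ^ M) * H ^ (a' * M) * Real.exp (u * τ) := by ring
  have hcE : Real.exp (-(c * H ^ (-a') * τ)) = Real.exp (-(u * τ)) * Real.exp (-(u * τ)) := by
    rw [← Real.exp_add, hu]
    congr 1
    ring
  calc Real.exp (-(c * H ^ (-a') * τ)) * (1 + τ) ^ M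
      ≤ Real.exp (-(c * H ^ (-a') * τ)) * ((2 : ℝ) ^ M * (1 + τ ^ M)) := mul_le_mul_of_nonneg_left h1 (Real.exp_pos _).le
    _ ≤ Real.exp (-(c * H ^ (-a') * τ)) * ((2 : ℝ) ^ M * ((c₀ ^ (-(a' * M)) + (M.factorial : ℝ) * (2 / c) ^ M) * H ^ (a' * M) * Real.exp (u * τ))) :=
        mul_le_mul_of_nonneg_left (mul_le_mul_of_nonneg_left hkey (by positivity)) (Real.exp_pos _).le
    _ = (2 : ℝ) ^ M * (c₀ ^ (-(a' * M)) + (M.factorial : ℝ) * (2 / c) ^ M) * H ^ (a' * M) *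
          (Real.exp (u * τ) * (Real.exp (-(u * τ)) * Real.exp (-(u * τ)))) := by rw [hcE]; ring
    _ = (2 : ℝ) ^ M * (c₀ ^ (-(a' * M)) + (M.factorial : ℝ) * (2 / c) ^ M) * H ^ (a' * M) * Real.exp (-(c / 2 * H ^ (-a') * τ)) := by
        rw [← Real.exp_add, ← Real.exp_add, hu]
        congr 1
        ring

/-! ## §2 The decay letter with local exponents -/

section Dec

variable (L : Type) [Field L] [NumberField L] {N : ℕ} [NeZero N] {n : ℕ}

/-- **`hdec` FROM A LOCAL LETTER WITH EXPONENTS LOCAL IN `s`.**  As ★ `hdec_of_letters` (indices `mat i`, points `ht x`, family `A`, the TOP's size `τ i` with `hτ`, `hdet0`, the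
support letter `hsupp` with `C_W, κ`), but the local decay letter carries its polynomial exponent `N₁` and its determinant-defect exponent `N′` INSIDE the `∀ z`:
`hloc : ∀ z, 0 < re z → ∃ N₁ N′ C a c a′ r, … ‖A i s x‖ ≤ C ‖x‖^a (e^{−c ‖x‖^{−a′} τ i} (1 + τ i)^{N₁}) ∏_{w∣∞} (1 + |det(mat i)|_w⁻¹)^{N′}`.
THEN the TOP's `hdec` with `N_W := 0`: `∃ N_W, ∀ z, 0 < re z → ∃ C a c a′ r, … ‖A i s x‖ ≤ C ‖x‖^a (e^{−c ‖x‖^{−a′} τ i} (1 + τ i)^{N_W})`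
(per `z`: ★ `hdec_of_letters` for the family truncated to the `z`-ball, then §1 with the height floor ★ `exists_adelicHeightGL_floor`).
[cite: MoeglinWaldspurger1995, II.1.7, IV.1.9] [cite: Shimura1982, §3] [cite: Shimura1997, §18.4 Prop. 18.14] [cite: BorelJacquet1979, §1.2] -/
theorem hdec_of_letters_local {ι X : Type*} (mat : ι → Matrix (Fin n) (Fin n) L) (ht : X → GL (Fin N) (AdeleRing (𝓞 L) L)) (A : ι → ℂ → X → ℂ)
    (τ : ι → ℝ) (hτ : ∀ i, ‖fun a b => mixedEmbedding L (mat i a b)‖ ≤ τ i)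
    (hdet0 : ∀ (i : ι) (s : ℂ) (x : X), (mat i).det = 0 → A i s x = 0)
    {CW κ : ℝ} (hCW : 0 < CW) (hκ : 0 ≤ κ)
    (hsupp : ∀ (i : ι) (s : ℂ) (x : X), 0 < s.re → A i s x ≠ 0 →
      ∃ D : ℕ, 1 ≤ D ∧ (D : ℝ) ≤ CW * adelicHeightGL N L (ht x) ^ κ ∧ ∀ a b, IsIntegral ℤ ((D : L) * mat i a b))
    (hloc : ∀ z : ℂ, 0 < z.re → ∃ (N₁ N' : ℕ) (C a c a' r : ℝ), 0 ≤ C ∧ 0 ≤ a ∧ 0 < c ∧ 0 ≤ a' ∧ 0 < r ∧ ∀ (i : ι) (s : ℂ), dist s z < r → ∀ x : X,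
      ‖A i s x‖ ≤ C * adelicHeightGL N L (ht x) ^ a *
        (Real.exp (-(c * adelicHeightGL N L (ht x) ^ (-a') * τ i)) * (1 + τ i) ^ N₁) * ∏ w : InfinitePlace L, (1 + (w (mat i).det)⁻¹) ^ N') :
    ∃ NW : ℕ, ∀ z : ℂ, 0 < z.re → ∃ C a c a' r : ℝ, 0 ≤ C ∧ 0 ≤ a ∧ 0 < c ∧ 0 ≤ a' ∧ 0 < r ∧ ∀ (i : ι) (s : ℂ), dist s z < r → ∀ x : X,
      ‖A i s x‖ ≤ C * adelicHeightGL N L (ht x) ^ a *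
        (Real.exp (-(c * adelicHeightGL N L (ht x) ^ (-a') * τ i)) * (1 + τ i) ^ NW) := by
  obtain ⟨c₀, hc₀, hfloor⟩ := exists_adelicHeightGL_floor L N
  refine ⟨0, fun z hz => ?_⟩
  obtain ⟨N₁, N', C, a, c, a', r, hC, ha, hc, ha', hr, hb⟩ := hloc z hz
  -- the family truncated to the `z`-ball satisfies every letter of ★ `hdec_of_letters` with the exponents `N₁ N′` of `z`
  set A' : ι → ℂ → X → ℂ := fun i s x => if dist s z < r then A i s x else 0 with hA'
  have hdet0' : ∀ (i : ι) (s : ℂ) (x : X), (mat i).det = 0 → A' i s x = 0 := fun i s x h => by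
    simp only [hA']
    split_ifs
    · exact hdet0 i s x h
    · rfl
  have hsupp' : ∀ (i : ι) (s : ℂ) (x : X), 0 < s.re → A' i s x ≠ 0 →
      ∃ D : ℕ, 1 ≤ D ∧ (D : ℝ) ≤ CW * adelicHeightGL N L (ht x) ^ κ ∧ ∀ a b, IsIntegral ℤ ((D : L) * mat i a b) := fun i s x hs h => by
    refine hsupp i s x hs fun h0 => h ?_
    simp only [hA', h0, ite_self]
  have hloc' : ∀ z' : ℂ, 0 < z'.re → ∃ C a c a' r' : ℝ, 0 ≤ C ∧ 0 ≤ a ∧ 0 < c ∧ 0 ≤ a' ∧ 0 < r' ∧ ∀ (i : ι) (s : ℂ), dist s z' < r' → ∀ x : X,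
      ‖A' i s x‖ ≤ C * adelicHeightGL N L (ht x) ^ a *
        (Real.exp (-(c * adelicHeightGL N L (ht x) ^ (-a') * τ i)) * (1 + τ i) ^ N₁) * ∏ w : InfinitePlace L, (1 + (w (mat i).det)⁻¹) ^ N' :=
    fun z' _ => ⟨C, a, c, a', 1, hC, ha, hc, ha', one_pos, fun i s _ x => by
      by_cases hsz : dist s z < r
      · simp only [hA', if_pos hsz]
        exact hb i s hsz x
      · simp only [hA', if_neg hsz, norm_zero]
        have hτ0 : 0 ≤ τ i := (norm_nonneg _).trans (hτ i)
        exact mul_nonneg (mul_nonneg (mul_nonneg hC (Real.rpow_nonneg (adelicHeightGL_pos_holds (ht x)).le _))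
          (mul_nonneg (Real.exp_pos _).le (pow_nonneg (by linarith) _)))
          (Finset.prod_nonneg fun w _ => pow_nonneg (add_nonneg zero_le_one (inv_nonneg.2 (apply_nonneg _ _))) _)⟩
  obtain ⟨NW, hdec'⟩ := hdec_of_letters L mat ht A' τ hτ hdet0' hCW hκ hsupp' N₁ N' hloc'
  obtain ⟨C₁, a₁, c₁, a'₁, r₁, hC₁, ha₁, hc₁, ha'₁, hr₁, hb₁⟩ := hdec' z hz
  -- absorb `(1 + τ i)^{N_W(z)}` into the Gaussian (§1)
  set K : ℝ := (2 : ℝ) ^ NW * (c₀ ^ (-(a'₁ * NW)) + (NW.factorial : ℝ) * (2 / c₁) ^ NW) with hK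
  have hK0 : 0 ≤ K := by positivity
  refine ⟨C₁ * K, a₁ + a'₁ * NW, c₁ / 2, a'₁, min r r₁, mul_nonneg hC₁ hK0, by positivity, half_pos hc₁, ha'₁, lt_min hr hr₁, fun i s hs x => ?_⟩
  have hsr : dist s z < r := lt_of_lt_of_le hs (min_le_left _ _)
  have hsr₁ : dist s z < r₁ := lt_of_lt_of_le hs (min_le_right _ _)
  have hAA : A i s x = A' i s x := by simp only [hA', if_pos hsr]
  have hHpos : 0 < adelicHeightGL N L (ht x) := adelicHeightGL_pos_holds (ht x)
  have hτ0 : 0 ≤ τ i := (norm_nonneg _).trans (hτ i)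
  rw [hAA, pow_zero, mul_one]
  calc ‖A' i s x‖ ≤ C₁ * adelicHeightGL N L (ht x) ^ a₁ *
        (Real.exp (-(c₁ * adelicHeightGL N L (ht x) ^ (-a'₁) * τ i)) * (1 + τ i) ^ NW) := hb₁ i s hsr₁ x
    _ ≤ C₁ * adelicHeightGL N L (ht x) ^ a₁ *
        (K * adelicHeightGL N L (ht x) ^ (a'₁ * NW) * Real.exp (-(c₁ / 2 * adelicHeightGL N L (ht x) ^ (-a'₁) * τ i))) :=
          mul_le_mul_of_nonneg_left (one_add_pow_mul_exp_neg_le hc₁ hc₀ (hfloor (ht x)) ha'₁ hτ0 NW) (by positivity)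
    _ = C₁ * K * (adelicHeightGL N L (ht x) ^ a₁ * adelicHeightGL N L (ht x) ^ (a'₁ * NW)) *
        Real.exp (-(c₁ / 2 * adelicHeightGL N L (ht x) ^ (-a'₁) * τ i)) := by ring
    _ = C₁ * K * adelicHeightGL N L (ht x) ^ (a₁ + a'₁ * NW) * Real.exp (-(c₁ / 2 * adelicHeightGL N L (ht x) ^ (-a'₁) * τ i)) := by
          rw [← Real.rpow_add hHpos]

end Dec

/-! ## §3 (D-loc) from the presentation with local exponents -/

section Dloc

variable (L : Type) [Field L] [NumberField L] {N : ℕ} [NeZero N] {n : ℕ}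

/-- **(D-loc) FROM THE PRESENTATION, EXPONENTS LOCAL IN `s`.**  As ★ `dloc_of_presentation` (presentation `hpres` ∕ `hdet0`, `#J i x ≤ N_J`, (S-loc) with `(T_δ, δ, k)`, least
denominators `D i` with `hDmin`), but the per-term size letters carry their exponents INSIDE the `∀ z`:
ARCH `∀ z, 0 < re z → ∃ N₁ N′ C a c a′ r, … ‖∏_σ F_{∞,σ,j} i s x‖ ≤ C‖x‖^a (e^{−c‖x‖^{−a′}τ i}(1+τ i)^{N₁}) ∏_{w∣∞}(1+|det(mat i)|_w⁻¹)^{N′}`,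
FINITE `∀ z, 0 < re z → ∃ N₂ N₃ C a r, … ‖∏_{v∈T} F_{v,j} i s x‖ ≤ C‖x‖^a (1+τ i)^{N₂} (D i)^{N₃}`.
THEN (D-loc) in the local shape of §2: `∀ z, 0 < re z → ∃ N₁″ N′ C a c a′ r, … ‖A i s x‖ ≤ C‖x‖^a (e^{…}(1+τ i)^{N₁″}) ∏_{w∣∞}(1+|det(mat i)|_w⁻¹)^{N′}` (`N₁″ = N₁ + N₂`;
★ STAGE 2's proof, per `z`). [cite: MoeglinWaldspurger1995, II.1.7, IV.1.9] [cite: Tan1999, §4 Prop. 4.8] [cite: Shimura1997, §18.4 Prop. 18.14] [cite: BorelJacquet1979, §1.2] -/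
theorem dloc_of_presentation_local {ι X κT Sinf : Type*} [Fintype Sinf]
    (mat : ι → Matrix (Fin n) (Fin n) L) (ht : X → GL (Fin N) (AdeleRing (𝓞 L) L)) (A : ι → ℂ → X → ℂ) (τ : ι → ℝ) (hτ0 : ∀ i, 0 ≤ τ i)
    (hdet0 : ∀ (i : ι) (s : ℂ) (x : X), (mat i).det = 0 → A i s x = 0)
    (J : ι → X → Finset κT) (NJ : ℕ) (hJ : ∀ i x, (J i x).card ≤ NJ) (Tfin : ι → X → Finset (HeightOneSpectrum (𝓞 ↥(maximalRealSubfield L))))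
    (Finf : Sinf → κT → ι → ℂ → X → ℂ) (Ffin : HeightOneSpectrum (𝓞 ↥(maximalRealSubfield L)) → κT → ι → ℂ → X → ℂ)
    (hpres : ∀ (i : ι) (s : ℂ) (x : X), (mat i).det ≠ 0 → 0 < s.re →
      A i s x = ∑ j ∈ J i x, (∏ σ, Finf σ j i s x) * ∏ v ∈ Tfin i x, Ffin v j i s x)
    -- (S-loc) with its defect datum
    (Tδ : Finset (HeightOneSpectrum (𝓞 L))) (δ : HeightOneSpectrum (𝓞 L) → ℕ) (hδ : ∀ w ∉ Tδ, δ w = 0) (k : ℕ)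
    (hSloc : ∀ (i : ι) (s : ℂ) (x : X), 0 < s.re → A i s x ≠ 0 → ∀ w : HeightOneSpectrum (𝓞 L), ∃ m : ℕ,
      ((Ideal.absNorm w.asIdeal : ℕ) : ℝ) ^ m ≤ ((Ideal.absNorm w.asIdeal : ℕ) : ℝ) ^ δ w * (GLn.localHeight N L w (ht x) : ℝ) ^ k ∧
        ∀ a b, Valued.v (((mat i a b : L)) : w.adicCompletion L) ≤ WithZero.exp (m : ℤ))
    -- the least denominator of `mat i`
    (D : ι → ℕ) (hDmin : ∀ (i : ι) (D' : ℕ), 1 ≤ D' → (∀ a b, IsIntegral ℤ ((D' : L) * mat i a b)) → D i ≤ D')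
    -- the per-term size letters, exponents local in `s`
    (harch : ∀ z : ℂ, 0 < z.re → ∃ (N₁ N' : ℕ) (C a c a' r : ℝ), 0 ≤ C ∧ 0 ≤ a ∧ 0 < c ∧ 0 ≤ a' ∧ 0 < r ∧ ∀ (j : κT) (i : ι) (s : ℂ), dist s z < r → ∀ x : X,
      ‖∏ σ, Finf σ j i s x‖ ≤ C * adelicHeightGL N L (ht x) ^ a *
        (Real.exp (-(c * adelicHeightGL N L (ht x) ^ (-a') * τ i)) * (1 + τ i) ^ N₁) * ∏ w : InfinitePlace L, (1 + (w (mat i).det)⁻¹) ^ N')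
    (hfsize : ∀ z : ℂ, 0 < z.re → ∃ (N₂ N₃ : ℕ) (C a r : ℝ), 0 ≤ C ∧ 0 ≤ a ∧ 0 < r ∧ ∀ (j : κT) (i : ι) (s : ℂ), dist s z < r → ∀ x : X,
      ‖∏ v ∈ Tfin i x, Ffin v j i s x‖ ≤ C * adelicHeightGL N L (ht x) ^ a * (1 + τ i) ^ N₂ * (D i : ℝ) ^ N₃) :
    ∀ z : ℂ, 0 < z.re → ∃ (N₁ N' : ℕ) (C a c a' r : ℝ), 0 ≤ C ∧ 0 ≤ a ∧ 0 < c ∧ 0 ≤ a' ∧ 0 < r ∧ ∀ (i : ι) (s : ℂ), dist s z < r → ∀ x : X,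
      ‖A i s x‖ ≤ C * adelicHeightGL N L (ht x) ^ a *
        (Real.exp (-(c * adelicHeightGL N L (ht x) ^ (-a') * τ i)) * (1 + τ i) ^ N₁) * ∏ w : InfinitePlace L, (1 + (w (mat i).det)⁻¹) ^ N' := by
  -- the support letter as a denominator bound (★ `hsupp_of_local`)
  obtain ⟨CW, κ, hCW, hκ, hsupp⟩ := hsupp_of_local L mat ht A Tδ δ hδ k hSloc
  intro z hz
  obtain ⟨N₁, N', C₁, a₁, c, a', r₁, hC₁, ha₁, hc, ha', hr₁, hb₁⟩ := harch z hz
  obtain ⟨N₂, N₃, C₂, a₂, r₂, hC₂, ha₂, hr₂, hb₂⟩ := hfsize z hz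
  refine ⟨N₁ + N₂, N', NJ * (C₁ * C₂ * CW ^ N₃), a₁ + a₂ + κ * N₃, c, a', min (min r₁ r₂) z.re, by positivity, by positivity, hc, ha',
    lt_min (lt_min hr₁ hr₂) hz, fun i s hs x => ?_⟩
  have hs₁ : dist s z < r₁ := lt_of_lt_of_le hs ((min_le_left _ _).trans (min_le_left _ _))
  have hs₂ : dist s z < r₂ := lt_of_lt_of_le hs ((min_le_left _ _).trans (min_le_right _ _))
  have hs0 : 0 < s.re := by
    have h1 : dist s z < z.re := lt_of_lt_of_le hs (min_le_right _ _)
    have h2 : |s.re - z.re| ≤ dist s z := by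
      rw [Complex.dist_eq, ← Complex.sub_re]
      exact Complex.abs_re_le_norm (s - z)
    have h3 := (abs_lt.1 (lt_of_le_of_lt h2 h1)).1
    linarith
  set H : ℝ := adelicHeightGL N L (ht x) with hH
  have hHpos : 0 < H := adelicHeightGL_pos_holds (ht x)
  set E : ℝ := Real.exp (-(c * H ^ (-a') * τ i)) with hE
  have hE0 : 0 < E := Real.exp_pos _
  set Df : ℝ := ∏ w : InfinitePlace L, (1 + (w (mat i).det)⁻¹) ^ N' with hDf
  have hDf0 : 0 ≤ Df := Finset.prod_nonneg fun w _ => pow_nonneg (add_nonneg zero_le_one (inv_nonneg.2 (apply_nonneg _ _))) _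
  have hτi := hτ0 i
  have hRHS0 : 0 ≤ NJ * (C₁ * C₂ * CW ^ N₃) * H ^ (a₁ + a₂ + κ * N₃) * (E * (1 + τ i) ^ (N₁ + N₂)) * Df := by positivity
  by_cases hA : A i s x = 0
  · rw [hA, norm_zero]; exact hRHS0
  have hdet : (mat i).det ≠ 0 := fun h => hA (hdet0 i s x h)
  -- the denominator against the height
  obtain ⟨D', hD'1, hD'le, hD'int⟩ := hsupp i s x hs0 hA
  have hDle : (D i : ℝ) ≤ CW * H ^ κ := le_trans (by exact_mod_cast hDmin i D' hD'1 hD'int) hD'le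
  have hD0 : (0 : ℝ) ≤ D i := Nat.cast_nonneg _
  have hDpow : (D i : ℝ) ^ N₃ ≤ CW ^ N₃ * H ^ (κ * N₃) := by
    calc (D i : ℝ) ^ N₃ ≤ (CW * H ^ κ) ^ N₃ := pow_le_pow_left₀ hD0 hDle N₃
      _ = CW ^ N₃ * H ^ (κ * N₃) := by rw [mul_pow, ← Real.rpow_natCast (H ^ κ), ← Real.rpow_mul hHpos.le]
  -- the term-wise bound
  have hterm : ∀ j ∈ J i x, ‖(∏ σ, Finf σ j i s x) * ∏ v ∈ Tfin i x, Ffin v j i s x‖ ≤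
      (C₁ * C₂ * CW ^ N₃) * H ^ (a₁ + a₂ + κ * N₃) * (E * (1 + τ i) ^ (N₁ + N₂)) * Df := by
    intro j _
    rw [norm_mul]
    have h₁ := hb₁ j i s hs₁ x
    have h₂ := hb₂ j i s hs₂ x
    have h₁0 : 0 ≤ C₁ * H ^ a₁ * (E * (1 + τ i) ^ N₁) * Df := by positivity
    calc ‖∏ σ, Finf σ j i s x‖ * ‖∏ v ∈ Tfin i x, Ffin v j i s x‖
        ≤ (C₁ * H ^ a₁ * (E * (1 + τ i) ^ N₁) * Df) * (C₂ * H ^ a₂ * (1 + τ i) ^ N₂ * (D i : ℝ) ^ N₃) :=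
          mul_le_mul h₁ h₂ (norm_nonneg _) h₁0
      _ ≤ (C₁ * H ^ a₁ * (E * (1 + τ i) ^ N₁) * Df) * (C₂ * H ^ a₂ * (1 + τ i) ^ N₂ * (CW ^ N₃ * H ^ (κ * N₃))) :=
          mul_le_mul_of_nonneg_left (mul_le_mul_of_nonneg_left hDpow (by positivity)) h₁0
      _ = (C₁ * C₂ * CW ^ N₃) * (H ^ a₁ * H ^ a₂ * H ^ (κ * N₃)) * (E * ((1 + τ i) ^ N₁ * (1 + τ i) ^ N₂)) * Df := by ring
      _ = (C₁ * C₂ * CW ^ N₃) * H ^ (a₁ + a₂ + κ * N₃) * (E * (1 + τ i) ^ (N₁ + N₂)) * Df := by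
          rw [← Real.rpow_add hHpos, ← Real.rpow_add hHpos, ← pow_add]
  -- sum over the `K`-finite index
  rw [hpres i s x hdet hs0]
  calc ‖∑ j ∈ J i x, (∏ σ, Finf σ j i s x) * ∏ v ∈ Tfin i x, Ffin v j i s x‖
      ≤ ∑ j ∈ J i x, ‖(∏ σ, Finf σ j i s x) * ∏ v ∈ Tfin i x, Ffin v j i s x‖ := norm_sum_le _ _
    _ ≤ ∑ _j ∈ J i x, (C₁ * C₂ * CW ^ N₃) * H ^ (a₁ + a₂ + κ * N₃) * (E * (1 + τ i) ^ (N₁ + N₂)) * Df := Finset.sum_le_sum hterm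
    _ = (J i x).card * ((C₁ * C₂ * CW ^ N₃) * H ^ (a₁ + a₂ + κ * N₃) * (E * (1 + τ i) ^ (N₁ + N₂)) * Df) := by
        rw [Finset.sum_const, nsmul_eq_mul]
    _ ≤ NJ * ((C₁ * C₂ * CW ^ N₃) * H ^ (a₁ + a₂ + κ * N₃) * (E * (1 + τ i) ^ (N₁ + N₂)) * Df) :=
        mul_le_mul_of_nonneg_right (by exact_mod_cast hJ i x) (by positivity)
    _ = NJ * (C₁ * C₂ * CW ^ N₃) * H ^ (a₁ + a₂ + κ * N₃) * (E * (1 + τ i) ^ (N₁ + N₂)) * Df := by ring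

end Dloc

/-! ## §4 STAGE 1 with local exponents -/

/-- **KIND W, STAGE 1 WITH LOCAL EXPONENTS.**  As ★ `exists_kindW_letters_of_globalLetters` (Euler data `(A, U, hEuler, hAd)` BY VALUE, `hdet0`, (S-loc) with `(T_δ, δ, k)`), but the
global decay letter (D-loc) carries its exponents INSIDE the `∀ z` (§2's `hloc` shape at `τ S := ‖(ι_∞ S_{ij})_{ij}‖`).  THEN the TOP's KIND-W block, conjuncts in the TOP's
order, with `N_W := 0`: `∃ A U, hEuler ∧ hAd ∧ ∃ τ N_W, hτ ∧ hdec ∧ ∃ C_W κ, 0 < C_W ∧ 0 ≤ κ ∧ hsupp` (★ `hsupp_of_local`, §2 `hdec_of_letters_local`, `hτ := le_rfl`).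
[cite: MoeglinWaldspurger1995, II.1.7, IV.1.9] [cite: KudlaRallis1994, §1] [cite: Tan1999, §4 Prop. 4.8] [cite: Shimura1997, §18.4 Prop. 18.14] [cite: BorelJacquet1979, §1.2] -/
theorem exists_kindW_letters_of_globalLetters_local
    (L : Type) [Field L] [NumberField L] [IsCMField L] {n : ℕ} (e : Fin 2 × Fin 1 ≃ Fin n)
    (dV : Fin 2 → L) (hdV : ∀ i, IsCMField.complexConj L (dV i) = dV i)
    (dW : Fin 1 → L) (hdW : ∀ i, IsCMField.complexConj L (dW i) = dW i)
    [MeasurableSpace (unipDelta L e dV hdV dW hdW)] (νN : Measure (unipDelta L e dV hdV dW hdW)) (f : ℂ → HA L e dV hdV dW hdW → ℂ)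
    (A : skewMatrices ((IsCMField.complexConj L : L ≃ₐ[Fp L] L) : L →+* L) ((gramR L e dV hdV dW hdW).map (algebraMap (Fp L) L)) → ℂ → HA L e dV hdV dW hdW → ℂ)
    (U : skewMatrices ((IsCMField.complexConj L : L ≃ₐ[Fp L] L) : L →+* L) ((gramR L e dV hdV dW hdW).map (algebraMap (Fp L) L)) → HA L e dV hdV dW hdW →
      Set (HeightOneSpectrum (𝓞 ↥(maximalRealSubfield L))))
    (hEuler : ∀ S : skewMatrices ((IsCMField.complexConj L : L ≃ₐ[Fp L] L) : L →+* L) ((gramR L e dV hdV dW hdW).map (algebraMap (Fp L) L)),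
      (S : Matrix (Fin n) (Fin n) L).det ≠ 0 → ∀ (s : ℂ) (h : HA L e dV hdV dW hdW), (n : ℝ) / 2 < s.re →
        whittakerDelta L e dV hdV dW hdW νN (S : Matrix (Fin n) (Fin n) L) (f s) h =
          A S s h * (partialStandardL (U S h) (fun _ => {1}) (2 * s + 1) *
            partialStandardL (U S h) (fun v => {(quadraticHeckeCharCM L).valueAtUniformizer v}) (2 * s + 2))⁻¹)
    (hAd : ∀ S (h : HA L e dV hdV dW hdW), DifferentiableOn ℂ (fun s => A S s h) {s : ℂ | 0 < s.re})
    (hdet0 : ∀ (S : skewMatrices ((IsCMField.complexConj L : L ≃ₐ[Fp L] L) : L →+* L) ((gramR L e dV hdV dW hdW).map (algebraMap (Fp L) L)))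
      (s : ℂ) (h : HA L e dV hdV dW hdW), (S : Matrix (Fin n) (Fin n) L).det = 0 → A S s h = 0)
    (Tδ : Finset (HeightOneSpectrum (𝓞 L))) (δ : HeightOneSpectrum (𝓞 L) → ℕ) (hδ : ∀ w ∉ Tδ, δ w = 0) (k : ℕ)
    (hSloc : ∀ (S : skewMatrices ((IsCMField.complexConj L : L ≃ₐ[Fp L] L) : L →+* L) ((gramR L e dV hdV dW hdW).map (algebraMap (Fp L) L)))
      (s : ℂ) (h : HA L e dV hdV dW hdW), 0 < s.re → A S s h ≠ 0 → ∀ w : HeightOneSpectrum (𝓞 L), ∃ m : ℕ,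
        ((Ideal.absNorm w.asIdeal : ℕ) : ℝ) ^ m ≤
            ((Ideal.absNorm w.asIdeal : ℕ) : ℝ) ^ δ w * (GLn.localHeight (n + n) L w (h : GL (Fin (n + n)) (AdeleRing (𝓞 L) L)) : ℝ) ^ k ∧
          ∀ a b, Valued.v ((((S : Matrix (Fin n) (Fin n) L) a b : L)) : w.adicCompletion L) ≤ WithZero.exp (m : ℤ))
    (hDloc : ∀ z : ℂ, 0 < z.re → ∃ (N₁ N' : ℕ) (C a c a' r : ℝ), 0 ≤ C ∧ 0 ≤ a ∧ 0 < c ∧ 0 ≤ a' ∧ 0 < r ∧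
      ∀ (S : skewMatrices ((IsCMField.complexConj L : L ≃ₐ[Fp L] L) : L →+* L) ((gramR L e dV hdV dW hdW).map (algebraMap (Fp L) L))) (s : ℂ),
        dist s z < r → ∀ h : HA L e dV hdV dW hdW,
        ‖A S s h‖ ≤ C * adelicHeightGL (n + n) L (h : GL (Fin (n + n)) (AdeleRing (𝓞 L) L)) ^ a *
          (Real.exp (-(c * adelicHeightGL (n + n) L (h : GL (Fin (n + n)) (AdeleRing (𝓞 L) L)) ^ (-a') *
              ‖(fun i j => NumberField.mixedEmbedding L ((S : Matrix (Fin n) (Fin n) L) i j))‖)) *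
            (1 + ‖(fun i j => NumberField.mixedEmbedding L ((S : Matrix (Fin n) (Fin n) L) i j))‖) ^ N₁) *
          ∏ w : InfinitePlace L, (1 + (w (S : Matrix (Fin n) (Fin n) L).det)⁻¹) ^ N') :
    ∃ (A : skewMatrices ((IsCMField.complexConj L : L ≃ₐ[Fp L] L) : L →+* L) ((gramR L e dV hdV dW hdW).map (algebraMap (Fp L) L)) → ℂ → HA L e dV hdV dW hdW → ℂ)
      (U : skewMatrices ((IsCMField.complexConj L : L ≃ₐ[Fp L] L) : L →+* L) ((gramR L e dV hdV dW hdW).map (algebraMap (Fp L) L)) → HA L e dV hdV dW hdW →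
        Set (HeightOneSpectrum (𝓞 ↥(maximalRealSubfield L)))),
      (∀ S : skewMatrices ((IsCMField.complexConj L : L ≃ₐ[Fp L] L) : L →+* L) ((gramR L e dV hdV dW hdW).map (algebraMap (Fp L) L)),
        (S : Matrix (Fin n) (Fin n) L).det ≠ 0 → ∀ (s : ℂ) (h : HA L e dV hdV dW hdW), (n : ℝ) / 2 < s.re →
          whittakerDelta L e dV hdV dW hdW νN (S : Matrix (Fin n) (Fin n) L) (f s) h =
            A S s h * (partialStandardL (U S h) (fun _ => {1}) (2 * s + 1) *
              partialStandardL (U S h) (fun v => {(quadraticHeckeCharCM L).valueAtUniformizer v}) (2 * s + 2))⁻¹) ∧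
      (∀ S (h : HA L e dV hdV dW hdW), DifferentiableOn ℂ (fun s => A S s h) {s : ℂ | 0 < s.re}) ∧
      ∃ (τ : skewMatrices ((IsCMField.complexConj L : L ≃ₐ[Fp L] L) : L →+* L) ((gramR L e dV hdV dW hdW).map (algebraMap (Fp L) L)) → ℝ) (NW : ℕ),
        (∀ S : skewMatrices ((IsCMField.complexConj L : L ≃ₐ[Fp L] L) : L →+* L) ((gramR L e dV hdV dW hdW).map (algebraMap (Fp L) L)),
          ‖(fun i j => NumberField.mixedEmbedding L ((S : Matrix (Fin n) (Fin n) L) i j))‖ ≤ τ S) ∧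
        (∀ z : ℂ, 0 < z.re → ∃ C a c a' r : ℝ, 0 ≤ C ∧ 0 ≤ a ∧ 0 < c ∧ 0 ≤ a' ∧ 0 < r ∧ ∀ S (s : ℂ), dist s z < r → ∀ h : HA L e dV hdV dW hdW,
          ‖A S s h‖ ≤ C * adelicHeightGL (n + n) L (h : GL (Fin (n + n)) (AdeleRing (𝓞 L) L)) ^ a *
            (Real.exp (-(c * adelicHeightGL (n + n) L (h : GL (Fin (n + n)) (AdeleRing (𝓞 L) L)) ^ (-a') * τ S)) * (1 + τ S) ^ NW)) ∧
        ∃ CW κ : ℝ, 0 < CW ∧ 0 ≤ κ ∧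
          ∀ S (s : ℂ) (h : HA L e dV hdV dW hdW), 0 < s.re → A S s h ≠ 0 →
            ∃ D : ℕ, 1 ≤ D ∧ (D : ℝ) ≤ CW * adelicHeightGL (n + n) L (h : GL (Fin (n + n)) (AdeleRing (𝓞 L) L)) ^ κ ∧
              ∀ i j, IsIntegral ℤ ((D : L) * (S : Matrix (Fin n) (Fin n) L) i j) := by
  have hn : 0 < n := by
    have h2 : Fintype.card (Fin 2 × Fin 1) = Fintype.card (Fin n) := Fintype.card_congr e
    simp only [Fintype.card_prod, Fintype.card_fin] at h2
    omega
  haveI : NeZero (n + n) := ⟨by omega⟩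
  -- (S-loc) ⟹ `hsupp` (★ `hsupp_of_local`)
  obtain ⟨CW, κ, hCW, hκ, hsupp⟩ := hsupp_of_local L
    (fun S : skewMatrices ((IsCMField.complexConj L : L ≃ₐ[Fp L] L) : L →+* L) ((gramR L e dV hdV dW hdW).map (algebraMap (Fp L) L)) =>
      (S : Matrix (Fin n) (Fin n) L))
    (fun h : HA L e dV hdV dW hdW => (h : GL (Fin (n + n)) (AdeleRing (𝓞 L) L))) A Tδ δ hδ k hSloc
  -- (D-loc) with local exponents + `hsupp` ⟹ `hdec` with `N_W := 0` (§2)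
  obtain ⟨NW, hdec⟩ := hdec_of_letters_local L
    (fun S : skewMatrices ((IsCMField.complexConj L : L ≃ₐ[Fp L] L) : L →+* L) ((gramR L e dV hdV dW hdW).map (algebraMap (Fp L) L)) =>
      (S : Matrix (Fin n) (Fin n) L))
    (fun h : HA L e dV hdV dW hdW => (h : GL (Fin (n + n)) (AdeleRing (𝓞 L) L))) A
    (fun S => ‖(fun i j => NumberField.mixedEmbedding L ((S : Matrix (Fin n) (Fin n) L) i j))‖) (fun S => le_rfl) hdet0 hCW hκ hsupp hDloc
  exact ⟨A, U, hEuler, hAd, fun S => ‖(fun i j => NumberField.mixedEmbedding L ((S : Matrix (Fin n) (Fin n) L) i j))‖, NW, fun S => le_rfl, hdec,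
    CW, κ, hCW, hκ, hsupp⟩

end Summit.HodgeConjecture.HodgeConjecture.Cruxes.HLiu418.K2LiuSiegelEisensteinKindWLocalExponents

end
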